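import Literature.NumberTheory.GelbartRogawski1991.DoubledWeilRepresentationUniqueness
import Literature.NumberTheory.GelbartRogawski1991.UndoublingPlaceAssembly
import HarnessLib

/-!
# The local factors of THE `χ`-attached splitting `ι̃_{V,χ}` ARE the local undoublings of the per-place package
# ([GelbartRogawski1991, Prop. 3.1.1] + [Kudla1994, Thm. 3.1] uniqueness, read for `Def411WeilCarriersDoubling.chiSplitting`)

Topic `NumberTheory/GelbartRogawski1991`; namespace `Literature.NumberTheory.GelbartRogawski1991.GRConstruction` (that of
`DoubledWeilRepresentationUniqueness` / `UndoublingPlaceAssembly`).  KERNEL ONLY: theorems; no definition, no named fact,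
no `sorry`.

[Liu2021, App. D §D.1 Step 2] attaches to a character `μ` THE splitting `ι_μ` «determined by doubling» ([HarrisKudlaSweet1996,
§1 (1.14)–(1.15), Cor. A.3]); the tree's term is `Liu2021.Def411WeilCarriersDoubling.chiSplitting χ := undoubleHom (doubledWeilRep χ)`
with `doubledWeilRep χ := Classical.choose (exists_isDoubledWeilRep χ)` — a CHOICE.  Two kernel theorems of the tree make that
choice canonical and factorisable: ★ `DoubledWeilUniqueness.isDoubledWeilRep_unique` / `undoubleHom_unique`
(`DoubledWeilRepresentationUniqueness`: two `χ`-normalised doubled Weil representations coincide) and ★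
`pairSmall₁_undoubleHom_assemble_finPairToAdelic_eq_localRefSection` (`UndoublingPlaceAssembly`: «undoubling commutes with
place-assembly»).  This file composes them:

* `doubledWeilRep_eq_of_isDoubledWeilRep` — `doubledWeilRep χ = sD` for EVERY `χ`-normalised doubled Weil representation `sD`;
* `chiSplitting_eq_undoubleHom` — `chiSplitting χ = undoubleHom sD` for every such `sD`;
* `chiSplitting_eq_undoubleHom_assemble` — in particular `chiSplitting χ = undoubleHom (assemble (finHalf 𝓕) sa)` for EVERY
  per-place package `𝓕 : FinLocalFamily χ 𝔪` and archimedean half `sa`;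
* **`pairSmall₁_chiSplitting_finPairToAdelic_eq_localRefSection`** — hence THE `χ`-splitting, read on the finite-adelic dual pair
  `U(diag dV)(𝔸_f) × U(diag dW)(𝔸_f)`, IS the reference section `localRefSection` assembled from the LOCAL undoublings
  `undoubledSplittings 𝓕` of ANY package `𝓕` (its local factor at `v` is `undoubleLoc (𝓕.𝓓 v).localSplitting`; for the CM
  package of `nonempty_finLocalFamily`, `𝓓 v = cmDatumAt χ v` = the split datum `localSplittingDatumSplit` at a split `v` with
  `χv w := (χ.localComponent w)⁻¹`, the non-split datum otherwise);
* **`pairSmall₁_chiSplittingLine_finPairToAdelic_eq_localRefSection`** — the same for the splitting transported to a hermitian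
  line datum `(diagonal dV, J_W = T_W ⊗ L)`, `Def411WeilCarriersDoubling.chiSplittingLine` (the term the [Liu2021] Weil carriers
  consume), through ★ `pairSmall₁_splittingCongr_undoubleHom_assemble_eq_localRefSection`.

No mathematics beyond the two ★ inputs: every proof is a rewrite along uniqueness.  Written for the d6 line of cell
`hodgecm-mathlib` (card S4b, step S4b-1: «the local factors of THE θ-splitting are the local undoublings»); the identification
of the split-place local factor's mixed-model character (S4b-3) is NOT addressed here.  HC_CM is NOT proved by anything here.

## References
* [GelbartRogawski1991] S. Gelbart, J. Rogawski, *L-functions and Fourier–Jacobi coefficients for the unitary group U(3)*,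
  Invent. Math. 105 (1991), §3.1 Prop. 3.1.1 p. 455 L1–3, Remark p. 457.
* [Kudla1994] S. Kudla, *Splitting metaplectic covers of dual reductive pairs*, Israel J. Math. 87 (1994), §3 Thm. 3.1.
* [HarrisKudlaSweet1996] M. Harris, S. Kudla, W. J. Sweet, *Theta dichotomy for unitary groups*, J. AMS 9 (1996), §1
  (1.14)–(1.16), Cor. A.3.
* [Liu2021] Y. Liu, *Fourier–Jacobi cycles and arithmetic relative trace formula*, Camb. J. Math. 9 (2021), App. D §D.1 Step 2
  (FJcycle.tex l. 5219).
-/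

set_option autoImplicit false

noncomputable section

open scoped Matrix Kronecker TensorProduct Classical
open NumberField IsDedekindDomain
open Literature.RepresentationTheory.HeisenbergGroup
open Literature.NumberTheory.Automorphic
open Literature.NumberTheory.Weil1964
open Literature.RepresentationTheory.HarrisKudlaSweet1996
open Literature.NumberTheory.GaloisRepresentations
open Literature.NumberTheory.Automorphic.Liu2021.Def411WeilCarriersDoubling (doubledWeilRep isDoubledWeilRep_doubledWeilRep
  chiSplitting chiSplittingLine lineW complexConj_lineW lineW_ne_zero realDiagonal_lineW diagonal_lineW splittingCongr)

namespace Literature.NumberTheory.GelbartRogawski1991.GRConstruction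

open UnitaryDualPair UnitaryDualPair.LocalSplitting UnitaryDualPair.WeilCoinv MeasureTheory DoubledWeilUniqueness

variable (L : Type) [Field L] [NumberField L] [IsCMField L]
variable {N M n : ℕ} (e : Fin N × Fin M ≃ Fin n)
  (dV : Fin N → L) (hdV : ∀ i, IsCMField.complexConj L (dV i) = dV i) (hdV0 : ∀ i, dV i ≠ 0)
  (dW : Fin M → L) (hdW : ∀ i, IsCMField.complexConj L (dW i) = dW i) (hdW0 : ∀ i, dW i ≠ 0)
  (χ : HeckeCharacter L) (hχu : χ.IsUnitary) (hχs : IsSplittingChar L 1 χ)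

/-! ## §1 THE `χ`-normalised doubled Weil representation and THE `χ`-splitting are any of them -/

/-- **`doubledWeilRep χ = sD` for every `χ`-normalised doubled Weil representation `sD`** — the `Classical.choose` of
`Def411WeilCarriersDoubling.doubledWeilRep` is canonical (★ `isDoubledWeilRep_unique`).
[cite: Kudla1994, §3 Thm. 3.1] [cite: GelbartRogawski1991, §3.1 Prop. 3.1.1 p. 455 L1–2] -/
theorem doubledWeilRep_eq_of_isDoubledWeilRep {sD : HA L e dV hdV dW hdW →* MpD L e dV hdV dW hdW}
    (hsD : IsDoubledWeilRep L e dV hdV hdV0 dW hdW hdW0 χ sD) :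
    doubledWeilRep L e dV hdV hdV0 dW hdW hdW0 χ hχu hχs = sD :=
  isDoubledWeilRep_unique L e dV hdV hdV0 dW hdW hdW0 χ
    (isDoubledWeilRep_doubledWeilRep L e dV hdV hdV0 dW hdW hdW0 χ hχu hχs) hsD

/-- **`chiSplitting χ = undoubleHom sD` for every `χ`-normalised doubled Weil representation `sD`**
(★ `undoubleHom_unique`). [cite: HarrisKudlaSweet1996, §1 (1.14)–(1.16), Cor. A.3] [cite: Kudla1994, §3 Thm. 3.1] -/
theorem chiSplitting_eq_undoubleHom {sD : HA L e dV hdV dW hdW →* MpD L e dV hdV dW hdW}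
    (hsD : IsDoubledWeilRep L e dV hdV hdV0 dW hdW hdW0 χ sD) :
    chiSplitting L e dV hdV hdV0 dW hdW hdW0 χ hχu hχs = undoubleHom L e dV hdV hdV0 dW hdW hdW0 sD hsD.proj_eq :=
  undoubleHom_unique L e dV hdV hdV0 dW hdW hdW0 χ
    (isDoubledWeilRep_doubledWeilRep L e dV hdV hdV0 dW hdW hdW0 χ hχu hχs) hsD

variable (𝔪 : ∀ v, PlaceMeasure L v) (𝓕 : FinLocalFamily L e dV hdV hdV0 dW hdW hdW0 χ 𝔪)

/-- **`chiSplitting χ` is the undoubling of the doubled Weil representation ASSEMBLED from ANY per-place package `𝓕` and ANY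
archimedean half `sa`** (★ `isDoubledWeilRep_assemble` + `chiSplitting_eq_undoubleHom`).
[cite: GelbartRogawski1991, §3.1 Prop. 3.1.1 p. 455 L1–3] [cite: Kudla1994, §3 Thm. 3.1] -/
theorem chiSplitting_eq_undoubleHom_assemble
    {sa : UnitaryGroup.arch (Fp L) L (IsCMField.complexConj L) (n + n) (hermD L e dV hdV dW hdW) →* MpD L e dV hdV dW hdW}
    (ha : IsArchHalf L e dV hdV hdV0 dW hdW hdW0 χ sa) :
    chiSplitting L e dV hdV hdV0 dW hdW hdW0 χ hχu hχs =
      undoubleHom L e dV hdV hdV0 dW hdW hdW0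
        (assemble L e dV hdV hdV0 dW hdW hdW0 (finHalf_isFinHalf L e dV hdV hdV0 dW hdW hdW0 χ 𝔪 𝓕) ha)
        (isDoubledWeilRep_assemble L e dV hdV hdV0 dW hdW hdW0 χ
          (finHalf_isFinHalf L e dV hdV hdV0 dW hdW hdW0 χ 𝔪 𝓕) ha).proj_eq :=
  chiSplitting_eq_undoubleHom L e dV hdV hdV0 dW hdW hdW0 χ hχu hχs
    (isDoubledWeilRep_assemble L e dV hdV hdV0 dW hdW hdW0 χ (finHalf_isFinHalf L e dV hdV hdV0 dW hdW hdW0 χ 𝔪 𝓕) ha)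

/-! ## §2 The local factors of THE `χ`-splitting on the finite-adelic dual pair -/

include hχu hχs in
set_option maxHeartbeats 800000 in -- measured (400 k, 800 k]: the rewrite along uniqueness inside the pair-splitting telescope
/-- **THE `χ`-SPLITTING, READ ON THE FINITE-ADELIC DUAL PAIR, IS THE REFERENCE SECTION OF THE LOCAL UNDOUBLINGS of ANY
per-place package `𝓕`**: `(ι̃_χ)|_{U(diag dV)(𝔸_f) × U(diag dW)(𝔸_f)} = localRefSection (undoubledSplittings 𝓕)` — the local factor
of `chiSplitting χ` at a finite place `v` is `undoubleLoc (𝓕.𝓓 v).localSplitting`.  Proof: an archimedean half exists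
(`exists_isArchHalf`), `chiSplitting χ` is the undoubling of the assembled representation (`chiSplitting_eq_undoubleHom_assemble`),
and undoubling commutes with place-assembly (★ `pairSmall₁_undoubleHom_assemble_finPairToAdelic_eq_localRefSection`).
[cite: GelbartRogawski1991, §3.1 Prop. 3.1.1 p. 455 L1–3, Remark p. 457 L4–13] [cite: Kudla1994, §3 Thm. 3.1]
[cite: HarrisKudlaSweet1996, §1 (1.14)–(1.16), Cor. A.3] -/
theorem pairSmall₁_chiSplitting_finPairToAdelic_eq_localRefSection :
    (pairSmall₁ (Fp L) L (IsCMField.complexConj L) N M e (Matrix.diagonal dV) (Matrix.diagonal dW)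
        (chiSplitting L e dV hdV hdV0 dW hdW hdW0 χ hχu hχs)).comp
      (finPairToAdelic (Fp L) L (IsCMField.complexConj L) N M (Matrix.diagonal dV) (Matrix.diagonal dW)) =
    localRefSection (Fp L) L (IsCMField.complexConj L) N M e (Matrix.diagonal dV) (Matrix.diagonal dW)
      (complexConj_imagUnit L) (imagUnit_ne_zero L) (imagUnit_mul_self L) (realDiagonal_isSymm L dV hdV)
      (realDiagonal_isSymm L dW hdW) (realDiagonal_map L dV hdV).symm (realDiagonal_map L dW hdW).symm
      (undoubledSplittings L e dV hdV hdV0 dW hdW hdW0 χ 𝔪 𝓕) := by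
  have hsa := exists_isArchHalf L e dV hdV hdV0 dW hdW hdW0 χ hχu hχs
  obtain ⟨sa, ha⟩ := hsa
  rw [chiSplitting_eq_undoubleHom_assemble L e dV hdV hdV0 dW hdW hdW0 χ hχu hχs 𝔪 𝓕 ha]
  exact pairSmall₁_undoubleHom_assemble_finPairToAdelic_eq_localRefSection L e dV hdV hdV0 dW hdW hdW0 χ 𝔪 𝓕 ha

/-! ## §3 The same for the splitting at a hermitian LINE datum (`Def411WeilCarriersDoubling.chiSplittingLine`) -/

section Line

variable {N' n' : ℕ} (e₁ : Fin N' × Fin 1 ≃ Fin n')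
  (dV₁ : Fin N' → L) (hdV₁ : ∀ i, IsCMField.complexConj L (dV₁ i) = dV₁ i) (hdV₁0 : ∀ i, dV₁ i ≠ 0)

include hχu hχs in
set_option maxHeartbeats 800000 in -- measured (400 k, 800 k]: the rewrite along uniqueness inside the line telescope
/-- **THE `χ`-SPLITTING AT THE LINE `⟨T_W⟩`, READ ON THE FINITE-ADELIC DUAL PAIR `U(diag dV)(𝔸_f) × U(J_W)(𝔸_f)`, IS THE REFERENCE
SECTION of the transported local undoublings** `congrW … (undoubledSplittings 𝓕)` of ANY per-place package `𝓕` of the lane datum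
`dW := lineW T_W` — `chiSplittingLine χ T_W J_W = splittingCongr _ _ (chiSplitting χ)` (definition), `chiSplitting_eq_undoubleHom_assemble`,
and ★ `pairSmall₁_splittingCongr_undoubleHom_assemble_eq_localRefSection`.
[cite: GelbartRogawski1991, §3.1 Prop. 3.1.1 p. 455 L1–3, Remark p. 457 L4–13] [cite: Liu2021, App. D §D.1 Steps 1–2 (FJcycle.tex l. 5217–5219)]
[cite: Kudla1994, §3 Thm. 3.1] -/
theorem pairSmall₁_chiSplittingLine_finPairToAdelic_eq_localRefSection
    (TW : Matrix (Fin 1) (Fin 1) (Fp L)) (hW : TW.IsSymm) (hWd : IsUnit TW.det) (JW : Matrix (Fin 1) (Fin 1) L)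
    (hJW : JW = TW.map (algebraMap (Fp L) L)) (𝔪₁ : ∀ v, PlaceMeasure L v)
    (𝓕₁ : FinLocalFamily L e₁ dV₁ hdV₁ hdV₁0 (lineW L TW) (complexConj_lineW L TW) (lineW_ne_zero L TW hWd) χ 𝔪₁) :
    (pairSmall₁ (Fp L) L (IsCMField.complexConj L) N' 1 e₁ (Matrix.diagonal dV₁) JW
        (chiSplittingLine L e₁ dV₁ hdV₁ hdV₁0 χ hχu hχs TW hWd JW hJW)).comp
      (finPairToAdelic (Fp L) L (IsCMField.complexConj L) N' 1 (Matrix.diagonal dV₁) JW) =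
    localRefSection (Fp L) L (IsCMField.complexConj L) N' 1 e₁ (Matrix.diagonal dV₁) JW
      (complexConj_imagUnit L) (imagUnit_ne_zero L) (imagUnit_mul_self L) (realDiagonal_isSymm L dV₁ hdV₁) hW
      (realDiagonal_map L dV₁ hdV₁).symm hJW
      (congrW L e₁ dV₁ hdV₁ (lineW L TW) (complexConj_lineW L TW) (realDiagonal_lineW L TW) (diagonal_lineW L TW hJW)
        (undoubledSplittings L e₁ dV₁ hdV₁ hdV₁0 (lineW L TW) (complexConj_lineW L TW) (lineW_ne_zero L TW hWd) χ 𝔪₁ 𝓕₁)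
        hW hJW) := by
  have hsa := exists_isArchHalf L e₁ dV₁ hdV₁ hdV₁0 (lineW L TW) (complexConj_lineW L TW) (lineW_ne_zero L TW hWd) χ hχu hχs
  obtain ⟨sa, ha⟩ := hsa
  have h := chiSplitting_eq_undoubleHom_assemble L e₁ dV₁ hdV₁ hdV₁0 (lineW L TW) (complexConj_lineW L TW)
    (lineW_ne_zero L TW hWd) χ hχu hχs 𝔪₁ 𝓕₁ ha
  unfold chiSplittingLine
  rw [h]
  exact pairSmall₁_splittingCongr_undoubleHom_assemble_eq_localRefSection L e₁ dV₁ hdV₁ hdV₁0 (lineW L TW)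
    (complexConj_lineW L TW) (lineW_ne_zero L TW hWd) χ 𝔪₁ 𝓕₁ (realDiagonal_lineW L TW) (diagonal_lineW L TW hJW) hW hJW ha

end Line

end Literature.NumberTheory.GelbartRogawski1991.GRConstruction

end
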